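import Summits.ResolutionOfSingularities.ResolutionOfSingularities.Theorems.SplitTowerPoly
import Summits.ResolutionOfSingularities.ResolutionOfSingularities.Theorems.SplitCutClasses

/-!
# SplitTower (T3/·) — THE TWO SHAPES of the split-cone tower (ring level)

Node «SplitTower» of `decomp-res-lens-2` (g34), see `Theorems/MaxContactCutSplitTower.lean`.

Bundled ring-level data carried along the tower of blow-ups of the section curves of a split cone
(`SplitCut.SplitConeExit`), over the local ring `A` of a point:

* `SplitShape J P n k` — at a CLOSED-TYPE point of the section curve (`P` the prime of the curve, generated by the
  frame `c = (z, U, W)`, completed by a fourth parameter `w` to a regular system of parameters of `A`, `dim A = 4`):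
  `J = (splitCone z U G n + ε W^k + h)` with `G 0 = 1`, a middle coefficient `G j = u·ϖ^e` (`u` unit, `e ≤ j`,
  `ϖ` transversal or a unit), the vertex clause, `ε` a unit, `h` in the weight ideal `Wt(c; n, k, nk + 1)`,
  `n ∤ k`, and the binomial guard.  It is the tree's `SplitCut.SplitConeShape` WITHOUT the clause `n ≤ k`, which
  decreases along the tower (`k ↦ k − n`) and decides the exit (`k < n`).

Consequences proved here: weights of tail monomials (`wtIdeal_le_pow_succ`, `wtIdeal_le_sup`); DEPTH `J ⊆ Pⁿ ⊆ 𝔪ⁿ`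
while `n ≤ k` (`le_pow`); THE ORDER EXIT `J ⊄ 𝔪ⁿ` once `k < n` (`not_le_pow`, by the pinch order bound
`PinchTower.pinch_not_mem_pow`); the frame facts; the UNIT/CORE dichotomy of a closed-type point (`unit_or_core`); and
the `ϖ`-ADIC NORMAL FORM modulo the curve at a core point (`exists_unit_mul_pow_add`: `A/P` is regular local of
dimension one with uniformizer `ϖ̄`).

Sources: [Hironaka1964] Ch. III §3; [CossartJannsenSaito2020] Ch. 2; [Matsumura1987] Thm. 14.2, 17.10.
-/

open IsLocalRing
open Literature.AlgebraicGeometry.Resolution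
open Summit.ResolutionOfSingularities.ResolutionOfSingularities.Theorems.SplitCut (splitCone MiddleCoeff VertexTame)
open Summit.ResolutionOfSingularities.ResolutionOfSingularities.Theorems.JetCut (WtIdeal ladder_weight_step)
open Summit.ResolutionOfSingularities.ResolutionOfSingularities.Theorems.PurityCut (BinomGuard)

namespace Summit.ResolutionOfSingularities.ResolutionOfSingularities.Theorems.SplitTower

/-! ## §W  Weights -/

section Weight

variable {A : Type} [CommRing A]

/-- If every monomial of weight `≥ N` has total degree `≥ m`, the weight ideal lies in `(c)ᵐ`. [folklore] -/
theorem wtIdeal_le_pow_span (c : Fin 3 → A) {n k N m : ℕ}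
    (h : ∀ a b e : ℕ, N ≤ (a + b) * k + e * n → m ≤ a + b + e) :
    WtIdeal c n k N ≤ Ideal.span (Set.range c) ^ m := by
  apply Ideal.span_le.mpr
  rintro x ⟨a, b, e, hw, rfl⟩
  have h0 : c 0 ∈ Ideal.span (Set.range c) := Ideal.subset_span ⟨0, rfl⟩
  have h1 : c 1 ∈ Ideal.span (Set.range c) := Ideal.subset_span ⟨1, rfl⟩
  have h2 : c 2 ∈ Ideal.span (Set.range c) := Ideal.subset_span ⟨2, rfl⟩
  have hm : c 0 ^ a * c 1 ^ b * c 2 ^ e ∈ Ideal.span (Set.range c) ^ (a + b + e) := by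
    rw [pow_add, pow_add]
    exact Ideal.mul_mem_mul (Ideal.mul_mem_mul (Ideal.pow_mem_pow h0 a) (Ideal.pow_mem_pow h1 b))
      (Ideal.pow_mem_pow h2 e)
  exact Ideal.pow_le_pow_right (h a b e hw) hm

/-- **Tail monomials have degree `≥ n + 1`** while `n ≤ k`: `Wt(c; n, k, nk + 1) ⊆ (c)ⁿ⁺¹`. [folklore] -/
theorem wtIdeal_le_pow_succ (c : Fin 3 → A) {n k : ℕ} (hnk : n ≤ k) :
    WtIdeal c n k (n * k + 1) ≤ Ideal.span (Set.range c) ^ (n + 1) :=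
  wtIdeal_le_pow_span c fun _ _ _ hw => (ladder_weight_step hnk hw).1

/-- **Tail monomials are divisible by `z`, `U` or `W^{k+1}`**: `Wt(c; n, k, nk + 1) ⊆ (z, U) + (W^{k+1})`. [folklore] -/
theorem wtIdeal_le_sup (c : Fin 3 → A) (n k : ℕ) :
    WtIdeal c n k (n * k + 1) ≤ Ideal.span {c 0, c 1} ⊔ Ideal.span {c 2 ^ (k + 1)} := by
  apply Ideal.span_le.mpr
  rintro x ⟨a, b, e, hw, rfl⟩
  have hz : c 0 ∈ Ideal.span ({c 0, c 1} : Set A) := Ideal.subset_span (by simp)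
  have hU : c 1 ∈ Ideal.span ({c 0, c 1} : Set A) := Ideal.subset_span (by simp)
  rcases Nat.eq_zero_or_pos a with ha | ha
  · rcases Nat.eq_zero_or_pos b with hb | hb
    · subst ha; subst hb
      have he : k + 1 ≤ e := by
        by_contra hlt
        have h1 : e * n ≤ k * n := Nat.mul_le_mul_right n (by omega)
        have h3 : k * n = n * k := Nat.mul_comm k n
        simp only [add_zero, zero_mul, zero_add] at hw
        omega
      refine Ideal.mem_sup_right (Ideal.mem_span_singleton'.mpr ⟨c 2 ^ (e - (k + 1)), ?_⟩)
      rw [pow_zero, pow_zero, one_mul, one_mul, ← pow_add, Nat.sub_add_cancel he]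
    · exact Ideal.mem_sup_left (Ideal.mul_mem_right _ _
        (Ideal.mul_mem_left _ _ (Ideal.pow_mem_of_mem _ hU b hb)))
  · exact Ideal.mem_sup_left (Ideal.mul_mem_right _ _
      (Ideal.mul_mem_right _ _ (Ideal.pow_mem_of_mem _ hz a ha)))

/-- **The split cone lies in `(z, U)ⁿ`.** [folklore] -/
theorem splitCone_mem_pow_span (z U : A) (G : ℕ → A) (n : ℕ) :
    splitCone z U G n ∈ Ideal.span {z, U} ^ n := by
  unfold splitCone
  refine Ideal.sum_mem _ fun j hj => ?_
  have hj' : j ≤ n := Nat.lt_succ_iff.mp (Finset.mem_range.mp hj)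
  have hz : z ∈ Ideal.span ({z, U} : Set A) := Ideal.subset_span (by simp)
  have hU : U ∈ Ideal.span ({z, U} : Set A) := Ideal.subset_span (by simp)
  have h : z ^ (n - j) * U ^ j ∈ Ideal.span {z, U} ^ n := by
    have h := Ideal.mul_mem_mul (Ideal.pow_mem_pow hz (n - j)) (Ideal.pow_mem_pow hU j)
    rwa [← pow_add, Nat.sub_add_cancel hj'] at h
  rw [mul_assoc]
  exact Ideal.mul_mem_left _ _ h

/-- `(z, U) ⊆ (c)` for the frame `c = (z, U, W)`. [folklore] -/
theorem span_pair_le_span_range (c : Fin 3 → A) : Ideal.span {c 0, c 1} ≤ Ideal.span (Set.range c) := by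
  apply Ideal.span_le.mpr
  rintro x hx
  rcases hx with rfl | rfl
  · exact Ideal.subset_span ⟨0, rfl⟩
  · exact Ideal.subset_span ⟨1, rfl⟩

/-- **DEPTH**: `splitCone + ε W^k + h ∈ (c)ⁿ` while `n ≤ k`. [folklore] -/
theorem splitElt_mem_pow (c : Fin 3 → A) (G : ℕ → A) (ε h : A) {n k : ℕ} (hnk : n ≤ k)
    (hh : h ∈ WtIdeal c n k (n * k + 1)) :
    splitCone (c 0) (c 1) G n + ε * c 2 ^ k + h ∈ Ideal.span (Set.range c) ^ n := by
  refine Ideal.add_mem _ (Ideal.add_mem _ ?_ ?_) ?_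
  · exact Ideal.pow_right_mono (span_pair_le_span_range c) n (splitCone_mem_pow_span _ _ G n)
  · exact Ideal.mul_mem_left _ _
      (Ideal.pow_le_pow_right hnk
        (Ideal.pow_mem_pow (Ideal.subset_span ⟨2, rfl⟩ : c 2 ∈ Ideal.span (Set.range c)) k))
  · exact Ideal.pow_le_pow_right (Nat.le_succ n) (wtIdeal_le_pow_succ c hnk hh)

end Weight

/-! ## §X  The order exit of the split element -/

section Exit

/-- vector bookkeeping: `c = (c 0, c 1, c 2)`. [folklore] -/
theorem vec3_eq {α : Type} (c : Fin 3 → α) : ![c 0, c 1, c 2] = c := by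
  funext i; fin_cases i <;> rfl

variable {A : Type} [CommRing A] [IsLocalRing A]

/-- The pair `(c 0, c 1)` of a frame is part of a regular system of parameters. [folklore] -/
theorem isRsopPart_pair {c : Fin 3 → A} (hc : IsRsopPart c) : IsRsopPart ![c 0, c 1] := by
  have h := hc.comp (Fin.castLE (by norm_num : 2 ≤ 3)) (Fin.castLE_injective _)
  convert h using 1
  funext i; fin_cases i <;> rfl

/-- **THE ORDER EXIT** [KERNEL]: for a frame `c` (part of a regular system of parameters), `ε` a unit and a tail
`h ∈ Wt(c; n, k, nk + 1)`, the split element `splitCone + ε W^k + h` is NOT in `𝔪^{k+1}` (`n ≥ 1`): modulo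
`(z, U)` it is `(ε + W·r)·W^k`, and the pinch order bound applies. [cite: Matsumura1987, Thm. 17.10] -/
theorem splitElt_not_mem_pow_succ [IsNoetherianRing A] {c : Fin 3 → A} (hc : IsRsopPart c) (G : ℕ → A) {ε : A} (hε : IsUnit ε)
    {h : A} {n k : ℕ} (hh : h ∈ WtIdeal c n k (n * k + 1)) (hn : 1 ≤ n) :
    splitCone (c 0) (c 1) G n + ε * c 2 ^ k + h ∉ maximalIdeal A ^ (k + 1) := by
  have hsc : splitCone (c 0) (c 1) G n ∈ Ideal.span {c 0, c 1} :=
    Ideal.pow_le_self (by omega) (splitCone_mem_pow_span _ _ G n)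
  obtain ⟨p, q, hpq⟩ := Ideal.mem_span_pair.mp hsc
  obtain ⟨y, hy, w, hw, hyw⟩ := Submodule.mem_sup.mp (wtIdeal_le_sup c n k hh)
  obtain ⟨p', q', hpq'⟩ := Ideal.mem_span_pair.mp hy
  obtain ⟨r, hr⟩ := Ideal.mem_span_singleton'.mp hw
  have hzuv : IsRsopPart ![c 0, c 1, c 2] := by rwa [vec3_eq]
  have hm : c 2 * r ∈ maximalIdeal A := Ideal.mul_mem_right _ _ (hc.mem_maximalIdeal 2)
  have hlam : IsUnit (ε + c 2 * r) := by
    refine notMem_maximalIdeal.mp fun hsum => notMem_maximalIdeal.mpr hε ?_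
    have := Ideal.sub_mem _ hsum hm
    rwa [add_sub_cancel_right] at this
  have key : splitCone (c 0) (c 1) G n + ε * c 2 ^ k + h =
      c 1 ^ 0 * ((ε + c 2 * r) * c 2 ^ k + c 1 * (q + q')) + c 0 * (p + p') := by
    rw [← hyw, ← hpq', ← hr, ← hpq]; ring
  intro hmem
  have h' := PinchTower.pinch_not_mem_pow (k := k) (isRsopPart_pair hc) (Or.inr hzuv) hlam 0 (q + q') (p + p')
  rw [zero_add, ← key] at h'
  exact h' hmem

/-- **THE ORDER EXIT, ideal form**: `k < n ⇒ (splitCone + ε W^k + h) ⊄ 𝔪ⁿ`. [cite: Matsumura1987, Thm. 17.10] -/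
theorem span_splitElt_not_le_pow [IsNoetherianRing A] {c : Fin 3 → A} (hc : IsRsopPart c) (G : ℕ → A) {ε : A} (hε : IsUnit ε)
    {h : A} {n k : ℕ} (hh : h ∈ WtIdeal c n k (n * k + 1)) (hkn : k < n) :
    ¬ Ideal.span {splitCone (c 0) (c 1) G n + ε * c 2 ^ k + h} ≤ maximalIdeal A ^ n := fun hle =>
  splitElt_not_mem_pow_succ hc G hε hh (by omega)
    (Ideal.pow_le_pow_right (by omega) (hle (Ideal.subset_span rfl)))

end Exit

/-! ## §S  The two shapes -/

section Shape

/-- **SPLIT SHAPE DATA** at a closed-type point of a section curve (ring level, over the stalk `A`; see the file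
docstring): the tree's `SplitCut.SplitConeShape` minus the clause `n ≤ k`, bundled with its frame `(c, w)`, a
regular system of parameters of `A`.  DATA (a `structure` in `Type`). [folklore] -/
structure SplitShape {A : Type} [CommRing A] [IsLocalRing A] (J P : Ideal A) (n k : ℕ) where
  /-- the frame `c = (z, U, W)` of the curve -/
  c : Fin 3 → A
  /-- a fourth regular parameter -/
  w : A
  /-- the transversal parameter (or unit) of the middle coefficient -/
  ϖ : A
  /-- the cone coefficients -/
  G : ℕ → A
  /-- the corner unit -/
  ε : A
  /-- the tail -/
  h : A
  rsop_cw : IsRsopPart (Fin.append c ![w])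
  span_c : Ideal.span (Set.range c) = P
  span_cw : Ideal.span (Set.range c ∪ {w}) = maximalIdeal A
  ideal : J = Ideal.span {splitCone (c 0) (c 1) G n + ε * c 2 ^ k + h}
  G_zero : G 0 = 1
  mid : MiddleCoeff (maximalIdeal A) c ϖ G n
  vtx : VertexTame (maximalIdeal A) G n
  unit : IsUnit ε
  tail : h ∈ WtIdeal c n k (n * k + 1)
  ndvd : ¬ n ∣ k
  guard : BinomGuard (maximalIdeal A) n

variable {A : Type} [CommRing A] [IsLocalRing A] {J P : Ideal A} {n k : ℕ}

namespace SplitShape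

/-- The ring of a split shape is regular local. [cite: Matsumura1987, Thm. 14.2] -/
theorem isRegularLocalRing (D : SplitShape J P n k) : IsRegularLocalRing A := D.rsop_cw.isRegularLocalRing

/-- The frame `c` is part of a regular system of parameters. [cite: Matsumura1987, Thm. 14.2] -/
theorem rsop (D : SplitShape J P n k) : IsRsopPart D.c := D.rsop_cw.append_left

/-- The curve ideal `P = (c)` lies in `𝔪`. [folklore] -/
theorem le_maximalIdeal (D : SplitShape J P n k) : P ≤ maximalIdeal A :=
  D.span_c ▸ D.rsop.span_range_le_maximalIdeal

/-- The fourth parameter is NOT on the curve: `w ∉ P`. [cite: Matsumura1987, Thm. 14.2] -/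
theorem w_not_mem (D : SplitShape J P n k) : D.w ∉ P := fun hw => by
  have h := D.rsop_cw.not_mem_span_image (S := Set.range (Fin.castAdd 1)) (i := Fin.natAdd 3 0)
    (by rintro ⟨i, hi⟩; exact absurd (congrArg Fin.val hi) (by simp; omega))
  rw [Fin.append_right] at h
  refine h (D.span_c.ge.trans (Ideal.span_mono ?_) hw)
  rintro _ ⟨i, rfl⟩
  exact ⟨Fin.castAdd 1 i, ⟨i, rfl⟩, by simp⟩

/-- The curve ideal `P = (c)` is prime. [cite: Matsumura1987, Thm. 14.2] -/
theorem isPrime (D : SplitShape J P n k) : P.IsPrime := D.span_c ▸ D.rsop.isPrime_span_range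

/-- The split element generates `J`. [folklore] -/
theorem mem_ideal (D : SplitShape J P n k) : splitCone (D.c 0) (D.c 1) D.G n + D.ε * D.c 2 ^ k + D.h ∈ J :=
  D.ideal.symm.le (Ideal.mem_span_singleton_self _)

/-- `n + 1 ≤ k` while `n ≤ k` (as `n ∤ k`). [folklore] -/
theorem succ_le (D : SplitShape J P n k) (hnk : n ≤ k) : n + 1 ≤ k := by
  rcases hnk.lt_or_eq with h | h
  · exact h
  · exact absurd (h ▸ dvd_refl n) D.ndvd

/-- **DEPTH**: `J ⊆ Pⁿ` while `n ≤ k`. [folklore] -/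
theorem le_pow (D : SplitShape J P n k) (hnk : n ≤ k) : J ≤ P ^ n := by
  rw [D.ideal, Ideal.span_le, Set.singleton_subset_iff]
  have h := splitElt_mem_pow D.c D.G D.ε D.h hnk D.tail
  rwa [D.span_c] at h

/-- **DEPTH**: `J ⊆ 𝔪ⁿ` while `n ≤ k`. [folklore] -/
theorem le_maximalIdeal_pow (D : SplitShape J P n k) (hnk : n ≤ k) : J ≤ maximalIdeal A ^ n :=
  (D.le_pow hnk).trans (Ideal.pow_right_mono D.le_maximalIdeal n)

/-- **ORDER EXIT**: `k < n ⇒ J ⊄ 𝔪ⁿ`. [cite: Matsumura1987, Thm. 17.10] -/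
theorem not_le_pow (D : SplitShape J P n k) (hkn : k < n) : ¬ J ≤ maximalIdeal A ^ n := by
  haveI := D.isRegularLocalRing
  rw [D.ideal]; exact span_splitElt_not_le_pow D.rsop D.G D.unit D.tail hkn

/-- **THE UNIT / CORE DICHOTOMY of a closed-type point**: either some middle coefficient is a unit (a UNIT point),
or all of `G 1, …, G n` lie in `𝔪` (a CORE point; by the vertex clause). [folklore] -/
theorem unit_or_core (D : SplitShape J P n k) :
    (∃ i, 0 < i ∧ i < n ∧ IsUnit (D.G i)) ∨ ∀ i, 0 < i → i ≤ n → D.G i ∈ maximalIdeal A := by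
  by_cases hu : ∃ i, 0 < i ∧ i < n ∧ IsUnit (D.G i)
  · exact Or.inl hu
  · refine Or.inr fun i hi hin => ?_
    rcases hin.lt_or_eq with hlt | rfl
    · exact (mem_maximalIdeal _).mpr (mem_nonunits_iff.mpr fun h => hu ⟨i, hi, hlt, h⟩)
    · rcases D.vtx with h | ⟨j, hj, hjn, hju⟩
      · exact h
      · exact absurd ⟨j, hj, hjn, hju⟩ hu

/-- At a CORE point the middle parameter `ϖ` is transversal: `(c, ϖ) = 𝔪` (it cannot be a unit, `G j = u ϖ^e ∈ 𝔪`).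
[folklore] -/
theorem core_span (D : SplitShape J P n k) (hcore : ∀ i, 0 < i → i ≤ n → D.G i ∈ maximalIdeal A) :
    Ideal.span (Set.range D.c ∪ {D.ϖ}) = maximalIdeal A := by
  obtain ⟨j, e, u, hj, hjn, -, hu, hGj, hϖ⟩ := D.mid
  rcases hϖ with h | hϖu
  · exact h
  · exfalso
    have hmem := hcore j hj hjn.le
    rw [hGj] at hmem
    exact notMem_maximalIdeal.mpr (hu.mul (hϖu.pow e)) hmem

end SplitShape

end Shape

/-! ## §V  The `ϖ`-adic normal form modulo the curve at a core point -/

section NormalForm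

variable {A : Type} [CommRing A] [IsLocalRing A] [IsNoetherianRing A]

/-- **`ϖ`-ADIC NORMAL FORM MODULO THE CURVE**: if `(c, ϖ) = 𝔪` in a Noetherian local ring, every `g ∈ A` is
`u·ϖ^m + r` with `r ∈ (c)` and `u` ZERO OR A UNIT — the local ring `A/(c)` has principal maximal ideal `(ϖ̄)`, and
the `𝔪̄`-adic order of `ḡ ≠ 0` is attained (Krull's intersection theorem). [cite: Matsumura1987, Thm. 8.10;
ZariskiSamuel1960, Ch. VIII §1 (1)] -/
theorem exists_unit_mul_pow_add {d : ℕ} (c : Fin d → A) (ϖ : A)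
    (hcϖ : Ideal.span (Set.range c ∪ {ϖ}) = maximalIdeal A) (g : A) :
    ∃ (m : ℕ) (u r : A), (u = 0 ∨ IsUnit u) ∧ r ∈ Ideal.span (Set.range c) ∧ g = u * ϖ ^ m + r := by
  classical
  set P : Ideal A := Ideal.span (Set.range c) with hP
  by_cases hg : g ∈ P
  · exact ⟨0, 0, g, Or.inl rfl, hg, by ring⟩
  have hPle : P ≤ maximalIdeal A := by
    rw [← hcϖ]; exact Ideal.span_mono Set.subset_union_left
  haveI : IsLocalRing (A ⧸ P) := PinchTower.isLocalRing_quotient hPle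
  have hmax : maximalIdeal (A ⧸ P) = Ideal.span {Ideal.Quotient.mk P ϖ} := by
    rw [← PinchTower.map_mk_maximalIdeal_eq P, ← hcϖ, Ideal.map_span, Set.image_union, Set.image_singleton,
      Ideal.span_union]
    have h0 : Ideal.span (Ideal.Quotient.mk P '' Set.range c) = ⊥ := by
      rw [Ideal.span_eq_bot]
      rintro _ ⟨x, hx, rfl⟩
      exact Ideal.Quotient.eq_zero_iff_mem.mpr (Ideal.subset_span hx)
    rw [h0, bot_sup_eq]
  have hg0 : Ideal.Quotient.mk P g ≠ 0 := by rwa [Ne, Ideal.Quotient.eq_zero_iff_mem]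
  obtain ⟨m, hm, hm'⟩ := exists_mem_pow_and_not_mem_pow_succ hg0
  rw [hmax, Ideal.span_singleton_pow, Ideal.mem_span_singleton'] at hm
  obtain ⟨d, hd'⟩ := hm
  have hdu : IsUnit d := by
    refine notMem_maximalIdeal.mp fun hdm => hm' ?_
    rw [hmax, Ideal.mem_span_singleton'] at hdm
    obtain ⟨d', rfl⟩ := hdm
    rw [hmax, Ideal.span_singleton_pow, Ideal.mem_span_singleton']
    exact ⟨d', by rw [← hd']; ring⟩
  obtain ⟨u, hu⟩ := Ideal.Quotient.mk_surjective d
  haveI : IsLocalHom (Ideal.Quotient.mk P) := IsLocalHom.of_surjective _ Ideal.Quotient.mk_surjective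
  have huu : IsUnit u := isUnit_of_map_unit (Ideal.Quotient.mk P) u (by rw [hu]; exact hdu)
  refine ⟨m, u, g - u * ϖ ^ m, Or.inr huu, ?_, by ring⟩
  rw [← Ideal.Quotient.eq, map_mul, map_pow, hu, hd']

end NormalForm

end Summit.ResolutionOfSingularities.ResolutionOfSingularities.Theorems.SplitTower
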